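import Literature.NumberTheory.EllipticCurves.ComplexMultiplicationShaKnappProofs
import Literature.NumberTheory.EllipticCurves.ComplexMultiplicationIsogenyProofs
import HarnessLib

/-!
# bsd.S28 (Rubin): finiteness of `Ш(E/ℚ)` for CM curves with `L(E,1) ≠ 0` — level 6:
# only the `only if` half of the classification of rational CM `j`-invariants is an input

Sixth level of the decomposition of
`Literature.NumberTheory.EllipticCurves.shaFinite_of_hasCM_of_L_one_ne_zero` (**bsd.S28**, `Ш`
part: *for an elliptic curve `E/ℚ` with complex multiplication and `L(E/ℚ, 1) ≠ 0`, `Ш(E/ℚ)` is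
finite* — Rubin, Invent. Math. 89 (1987), §0 Remark (3), p. 528, from the paper's Theorem A,
p. 527, for `E_K` over the CM field `K`). Level 5
(`ComplexMultiplicationShaKnappProofs.lean`, `shaFinite_of_hasCM_of_L_one_ne_zero_of_level5`)
derived the target, sorry-free, from five printed statements:

1. Rubin 1987, Thm. 6.6 for `E_K` (`Rubin1987_sha_torsionBy_eq_bot_cofinite`);
2. Rubin 1987, §10: `Ш(E_K/K)_{𝔭^∞}` finite for every `𝔭` (`Rubin1987_sha_primary_finite`);
3. Deuring, `L(E_K/K, s) = L(E/ℚ, s)²` (`Deuring_LFunction_baseChange_cmField`);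
4. modularity, the entire continuation of `L(E/ℚ, s)` (`WeierstrassCurve.hasEntireLFunction_rat`);
5. the classification of the rational CM `j`-invariants (`WeierstrassCurve.hasCM_iff_j_mem`:
   `E/ℚ` has CM iff `j(E)` is one of the thirteen values of `cmJInvariants`; Silverman, *AEC*,
   App. C §11, Examples 11.3.1–11.3.2).

Leaf 5 is an `iff`, but the reduction uses one direction only: a CM curve `E/ℚ` must be placed
in the table of the thirteen `j`-invariants (`HasCM E → j(E) ∈ cmJInvariants`, the *only if*
half — integrality of singular moduli and the class number one problem, Heegner–Baker–Stark),
after which the explicit `ℚ`-isogenies of the table carry it to a curve with CM by the maximal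
order; the *if* half (each of the thirteen curves has CM) is never used. The tree meanwhile
isolates the *only if* half as its own named fact
`Literature.NumberTheory.EllipticCurves.j_mem_cmJInvariants_of_hasCM`
(`ComplexMultiplicationIsogenyProofs.lean`, introduced for the parallel reduction of the
Coates–Wiles part of bsd.S28, `finite_point_of_hasCM_of_L_one_ne_zero_of_CoatesWiles1977_of_j_mem_of_table_LFunction`),
and proves a large part of the *if* half separately (`ComplexMultiplicationHasCMProofs.lean`:
`j = 0, 1728, -3375, 8000, 54000, 287496`). This file reruns the last step of level 5 with the
weaker leaf, so that the `Ш` part and the Mordell–Weil part of bsd.S28 rest on the *same*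
classification input:

* `exists_isLocIsogenous_LFunction_eq_j_mem_maximalCMJInvariants_of_hasCM_of_j_mem_cmJInvariants_of_hasCM`:
  under the *only if* half, every CM curve over `ℚ` is joined to a curve with
  `j ∈ maximalCMJInvariants` by a `ℚ`-isogeny with local points maps and the same `L`-function
  (the identity if `j(E)` is already a maximal-order value, the level-5 table otherwise);
* `shaFinite_of_hasCM_of_L_one_ne_zero_of_maximalOrder_of_j_mem_cmJInvariants_of_hasCM`
  (**proved**): the `HasCM` form of bsd.S28 (`Ш` part) from its maximal-order case
  `shaFinite_of_j_mem_maximalCMJInvariants_of_L_one_ne_zero` and the *only if* half alone;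
* `shaFinite_of_hasCM_of_L_one_ne_zero_of_thmA` (**proved**): the target from Rubin's Theorem A
  for `E_K` (the level-1 leaf `Rubin1987_shaFinite_baseChange_cmField`), Deuring, modularity and
  the *only if* half — the form to use if Theorem A is vendored whole;
* `shaFinite_of_hasCM_of_L_one_ne_zero_of_level6` (**proved**): the target from leaves 1–4 and
  the *only if* half `j_mem_cmJInvariants_of_hasCM` in place of leaf 5.

After this file `shaFinite_of_hasCM_of_L_one_ne_zero` follows, sorry-free, from exactly these
named facts of the tree, each a single printed statement and each the subject of its own
decomposition elsewhere in this directory: `Rubin1987_sha_torsionBy_eq_bot_cofinite` and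
`Rubin1987_sha_primary_finite` (the two halves of Rubin's Theorem A, §10 of the paper),
`Deuring_LFunction_baseChange_cmField` (reduced in `ComplexMultiplicationDeuringArtinProofs.lean`
to Artin formalism for quadratic base change, the CM twist isogeny and Knapp 11.67),
`WeierstrassCurve.hasEntireLFunction_rat` (modularity; `AnalyticRankBCDTProofs.lean`) and
`j_mem_cmJInvariants_of_hasCM` (reduced in `ComplexMultiplicationJInvariantProofs.lean`).
Nothing in the statement of the target was changed.

## References

* K. Rubin, *Tate–Shafarevich groups and L-functions of elliptic curves with complex
  multiplication*, Invent. Math. 89 (1987), 527–560: Thm. A (p. 527), §0 Remark (3) (p. 528),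
  Thm. 6.6 (p. 541), §10 (pp. 548–549). [Rubin1987Sha]
* J. S. Milne, *Arithmetic Duality Theorems*, 2nd ed. (2006), Ch. I, Lemma 7.1(b), p. 96
  (finiteness of `Ш` is an isogeny invariant; proved in the tree for the isogenies used,
  `WeierstrassCurve.IsLocIsogenous.shaFinite_of_shaFinite`). [MilneADT2006]
* J. H. Silverman, *The Arithmetic of Elliptic Curves*, 2nd ed. (2009), App. C §11,
  Examples 11.3.1–11.3.2 (the thirteen rational CM `j`-invariants). [SilvermanAEC2009]
* J. H. Silverman, *Advanced Topics in the Arithmetic of Elliptic Curves* (1994), II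
  Exercise 2.12(b) and App. A §3. [SilvermanAdvancedTopics1994]
-/

noncomputable section

open scoped Classical

open WeierstrassCurve

namespace Literature.NumberTheory.EllipticCurves

/-! ### The table step under the `only if` half of the classification -/

/-- **Every CM curve over `ℚ` is joined to a maximal-order curve by a `ℚ`-isogeny with local
points maps and the same `L`-function — assuming only the `only if` half of the
classification.** If `E/ℚ` has CM then `j(E) ∈ cmJInvariants` (`h₁`); if `j(E)` is one of the
nine maximal-order values take the identity (`IsLocIsogenous.refl`, equal `L`-functions
trivially), otherwise `j(E) ∈ nonmaximalCMJInvariants = cmJInvariants \ maximalCMJInvariants`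
(`j_mem_nonmaximalCMJInvariants_of_hasCM`) and the level-5 table
`exists_isLocIsogenous_LFunction_eq_j_mem_maximalCMJInvariants_of_j_mem_nonmaximalCMJInvariants`
(Silverman's `2`-isogenies and Vélu's `3`-isogeny with their local points maps, and Knapp's
Thm. 11.67 proved for these four isogeny classes and all their quadratic twists) applies.
Same proof as the level-5
`exists_isLocIsogenous_LFunction_eq_j_mem_maximalCMJInvariants_of_hasCM_of_hasCM_iff_j_mem`, with
`hasCM_iff_j_mem` weakened to `j_mem_cmJInvariants_of_hasCM`.
[cite: SilvermanAdvancedTopics1994, Exercise 2.12(b) and App. A §3]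
[cite: SilvermanAEC2009, App. C §11, Example 11.3.1–11.3.2] -/
theorem exists_isLocIsogenous_LFunction_eq_j_mem_maximalCMJInvariants_of_hasCM_of_j_mem_cmJInvariants_of_hasCM
    (h₁ : j_mem_cmJInvariants_of_hasCM) (W : WeierstrassCurve ℚ) [W.IsElliptic]
    (hCM : W.HasCM) :
    ∃ (W' : WeierstrassCurve ℚ) (_ : W'.IsElliptic),
      IsLocIsogenous W W' ∧ W.LFunction = W'.LFunction ∧ W'.j ∈ maximalCMJInvariants := by
  by_cases hmax : W.j ∈ maximalCMJInvariants
  · exact ⟨W, ‹W.IsElliptic›, IsLocIsogenous.refl W, rfl, hmax⟩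
  · exact exists_isLocIsogenous_LFunction_eq_j_mem_maximalCMJInvariants_of_j_mem_nonmaximalCMJInvariants
      W (j_mem_nonmaximalCMJInvariants_of_hasCM h₁ hCM hmax)

/-! ### Assembly -/

/-- **bsd.S28 (`Ш` part), `HasCM` form, from its maximal-order case and the `only if` half of
the classification of rational CM `j`-invariants.** For `E/ℚ` with CM and `L(E/ℚ, 1) ≠ 0`: by
`h₁` and the table, `E` is joined by a `ℚ`-isogeny `φ` with local points maps to `E'` with
`j(E') ∈ maximalCMJInvariants` and `L(E', s) = L(E, s)` as Dirichlet series, hence with the same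
entire continuation (`entireLFunction_eq_of_LSeries_eq`), so `L(E', 1) ≠ 0`; `Ш(E'/ℚ)` is finite
by the maximal-order case (`h9`, Rubin 1987 Remark (3) for CM by `𝓞_K`); hence `Ш(E/ℚ)` is
finite, `Ш(φ)` having finite kernel (`IsLocIsogenous.shaFinite_of_shaFinite`: Milne, *ADT*,
Lemma I.7.1(b), proved in the tree via the dual isogeny and the finiteness of `Ш[deg φ]`). This
is Rubin's reduction to CM by the maximal order (1987, §10, p. 548) carried out over `ℚ`.
[cite: Rubin1987Sha, §0 Remark (3) (p. 528) and §10 (p. 548)]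
[cite: MilneADT2006, Ch. I Lemma 7.1(b), p. 96] -/
theorem shaFinite_of_hasCM_of_L_one_ne_zero_of_maximalOrder_of_j_mem_cmJInvariants_of_hasCM
    (h9 : shaFinite_of_j_mem_maximalCMJInvariants_of_L_one_ne_zero)
    (h₁ : j_mem_cmJInvariants_of_hasCM) : shaFinite_of_hasCM_of_L_one_ne_zero := by
  intro W _ hCM hL
  obtain ⟨W', hW', hiso, hLF, hj⟩ :=
    exists_isLocIsogenous_LFunction_eq_j_mem_maximalCMJInvariants_of_hasCM_of_j_mem_cmJInvariants_of_hasCM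
      h₁ W hCM
  haveI := hW'
  have hL' : W'.entireLFunction 1 ≠ 0 := by
    rwa [← entireLFunction_eq_of_LSeries_eq (LSeries_eq_of_LFunction_eq hLF)]
  exact hiso.shaFinite_of_shaFinite (h9 W' hj hL')

/-- **bsd.S28 (`Ш` part) from Rubin's Theorem A, Deuring, modularity and the `only if` half of
the classification.** `shaFinite_of_hasCM_of_L_one_ne_zero` follows, sorry-free, from Theorem A
of Rubin (1987) for the base change `E_K` of a maximal-order CM curve `E/ℚ` to its CM field
(`hA`, the level-1 leaf `Rubin1987_shaFinite_baseChange_cmField`), Deuring's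
`L(E_K/K, s) = L(E/ℚ, s)²` (`hD`), the entire continuation of `L(E/ℚ, s)` (`hmod`) and
`j_mem_cmJInvariants_of_hasCM` (`h₁`): the maximal-order case is
`shaFinite_of_j_mem_maximalCMJInvariants_of_L_one_ne_zero_of_facts hA hD hmod` (level 1:
`L(E_K/K, 1) = L(E/ℚ, 1)² ≠ 0`, Theorem A, and `Ш(E/ℚ) → Ш(E_K/K)` has finite kernel), and the
passage to arbitrary CM orders is the previous theorem.
[cite: Rubin1987Sha, Thm. A (p. 527) and §0 Remark (3) (p. 528)] -/
theorem shaFinite_of_hasCM_of_L_one_ne_zero_of_thmA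
    (hA : Rubin1987_shaFinite_baseChange_cmField) (hD : Deuring_LFunction_baseChange_cmField)
    (hmod : hasEntireLFunction_rat) (h₁ : j_mem_cmJInvariants_of_hasCM) :
    shaFinite_of_hasCM_of_L_one_ne_zero :=
  shaFinite_of_hasCM_of_L_one_ne_zero_of_maximalOrder_of_j_mem_cmJInvariants_of_hasCM
    (shaFinite_of_j_mem_maximalCMJInvariants_of_L_one_ne_zero_of_facts hA hD hmod) h₁

/-- **bsd.S28 (`Ш` part) after six levels of decomposition.**
`shaFinite_of_hasCM_of_L_one_ne_zero` (`E/ℚ` with CM and `L(E/ℚ, 1) ≠ 0 ⇒ Ш(E/ℚ)` finite;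
Rubin 1987, §0 Remark (3)) follows, sorry-free, from five named facts of the tree, each a single
printed statement: Rubin's Theorem 6.6 (`h66`) and the `𝔭`-primary finiteness of §10 (`h10`)
for `E_K` — the two halves of Theorem A —, Deuring's theorem (`hD`), modularity (`hmod`) and the
`only if` half of the classification of rational CM `j`-invariants (`h₁`, Silverman *AEC*
C.11.3.1–2). Compared with `shaFinite_of_hasCM_of_L_one_ne_zero_of_level5` the `if` half of
`hasCM_iff_j_mem` (that each of the thirteen curves has CM) is no longer an input. Proved in the
tree along the way (levels 1–5): Theorem A from its halves, Remark (3) from Theorem A, the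
explicit isogenies to maximal order with their local points maps, and the invariance along them
of the finiteness of `Ш` (Milne I.7.1(b)) and of the `L`-function (Knapp 11.67).
[cite: Rubin1987Sha, Thm. A, §0 Remark (3), Thm. 6.6 and §10]
[cite: MilneADT2006, Ch. I Lemma 7.1(b), p. 96] -/
theorem shaFinite_of_hasCM_of_L_one_ne_zero_of_level6
    (h66 : Rubin1987_sha_torsionBy_eq_bot_cofinite) (h10 : Rubin1987_sha_primary_finite)
    (hD : Deuring_LFunction_baseChange_cmField) (hmod : hasEntireLFunction_rat)
    (h₁ : j_mem_cmJInvariants_of_hasCM) : shaFinite_of_hasCM_of_L_one_ne_zero :=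
  shaFinite_of_hasCM_of_L_one_ne_zero_of_thmA
    (Rubin1987_shaFinite_baseChange_cmField_of_level2 h66 h10) hD hmod h₁

end Literature.NumberTheory.EllipticCurves

end
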